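import Literature.NumberTheory.NumberFields.SelmerGroupOddClass
import Literature.NumberTheory.NumberFields.ClassGroupCertDK
import HarnessLib

/-!
# `K(S, 2)` from units and generators of the cubes of the `S`-primes (`3`-torsion class group)

The variant of `SelmerGroupOddClass.lean` needed when the primes of `S` are NOT principal but every
ideal class has order dividing `3` (e.g. `Cl(K) ≅ C₃ × C₃` for the cyclic cubic field of conductor
`1339` in which `2` splits): if every prime `v ∋ D` has `v³ = (g_v)` with `g_v ∈ G`, then every
`b ∈ Kˣ` with `ord_v(b)` even for all `v ∌ D` is `u · ∏ l · □` for a unit `u` and a duplicate-free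
sublist `l` of `G` (`exists_isSquare_mul_of_two_dvd_log_valuation_of_cube`). Proof: as in the
odd-class-number file with `h = 3` — induction on the number of primes `∌ D` dividing `(a)`
(peeling `P³ = (π)`), and, when all primes dividing `(a)` contain `D`, induction on the norm of the
IDEAL (`J = M · J'`, `M³ = (g)`, so `(a)³ = (∏ l)`), then `a ≡ a³` modulo squares and removal of
repeated factors. [cite: SilvermanAEC2009, Prop. VIII.1.6 (proof)]

## References

* J. H. Silverman, *The Arithmetic of Elliptic Curves*, 2nd ed., GTM 106 (2009), Prop. VIII.1.6
  and its proof. [SilvermanAEC2009]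
-/

noncomputable section

open scoped NumberField nonZeroDivisors

open NumberField IsDedekindDomain IsDedekindDomain.HeightOneSpectrum Ideal

namespace Literature.NumberTheory.NumberFields

variable {K : Type*} [Field K] [NumberField K]

/-! ### Cubes of ideals supported above `S` -/

/-- **Ideals supported on primes whose cubes are `(g)`, `g ∈ G`, have cube `(∏ l)`** for a list
`l` of members of `G` (induction on the norm: `J = M · J'`, `M³ = (g)`). [folklore] -/
theorem ideal_cube_eq_span_prod (D : 𝓞 K) (G : List (𝓞 K))
    (hD : ∀ v : HeightOneSpectrum (𝓞 K), D ∈ v.asIdeal → ∃ g ∈ G, v.asIdeal ^ 3 = span {g}) :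
    ∀ (J : Ideal (𝓞 K)), J ≠ ⊥ → (∀ v : HeightOneSpectrum (𝓞 K), J ≤ v.asIdeal → D ∈ v.asIdeal) →
      ∃ l : List (𝓞 K), (∀ g ∈ l, g ∈ G) ∧ J ^ 3 = span {l.prod} := by
  suffices key : ∀ (n : ℕ) (J : Ideal (𝓞 K)), absNorm J = n → J ≠ ⊥ →
      (∀ v : HeightOneSpectrum (𝓞 K), J ≤ v.asIdeal → D ∈ v.asIdeal) →
      ∃ l : List (𝓞 K), (∀ g ∈ l, g ∈ G) ∧ J ^ 3 = span {l.prod} from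
    fun J hJ hsupp => key _ J rfl hJ hsupp
  intro n
  induction n using Nat.strong_induction_on with
  | _ n ih =>
  intro J hJn hJ0 hsupp
  by_cases htop : J = ⊤
  · exact ⟨[], by simp, by rw [htop, List.prod_nil, span_singleton_one]; simp⟩
  · obtain ⟨M, hMmax, hJM⟩ := exists_le_maximal J htop
    have hM0 : M ≠ ⊥ := fun h0 => hJ0 (le_bot_iff.mp (h0 ▸ hJM))
    set v : HeightOneSpectrum (𝓞 K) := ⟨M, hMmax.isPrime, hM0⟩ with hv
    obtain ⟨g, hgG, hvg⟩ := hD v (hsupp v hJM)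
    obtain ⟨J', hJ'⟩ : M ∣ J := dvd_iff_le.mpr hJM
    have hJ'0 : J' ≠ ⊥ := fun h => hJ0 (by rw [hJ', h, mul_bot])
    have hlt : absNorm J' < n := by
      rw [← hJn, hJ', map_mul]
      have h1 : 1 < absNorm M := one_lt_absNorm hMmax.isPrime hM0
      have h2 : 0 < absNorm J' := Nat.pos_of_ne_zero fun h => hJ'0 (absNorm_eq_zero_iff.mp h)
      nlinarith
    have hsupp' : ∀ w : HeightOneSpectrum (𝓞 K), J' ≤ w.asIdeal → D ∈ w.asIdeal :=
      fun w hw => hsupp w (hJ' ▸ mul_le_left.trans hw)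
    obtain ⟨l, hlG, hl⟩ := ih _ hlt J' rfl hJ'0 hsupp'
    refine ⟨g :: l, fun x hx => ?_, ?_⟩
    · rcases List.mem_cons.mp hx with rfl | hx
      · exact hgG
      · exact hlG x hx
    · rw [hJ', mul_pow, hl, List.prod_cons, ← span_singleton_mul_span_singleton]
      exact congrArg (· * span {l.prod}) hvg

omit [NumberField K] in
/-- **Removing repeated factors**: a list over `G` has product `∏ l' · c²` for a duplicate-free
sublist `l'`. [folklore] -/
theorem list_prod_eq_nodup_mul_sq [DecidableEq (𝓞 K)] (G : List (𝓞 K)) :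
    ∀ l : List (𝓞 K), (∀ g ∈ l, g ∈ G) →
      ∃ (l' : List (𝓞 K)) (c : 𝓞 K), (∀ g ∈ l', g ∈ G) ∧ l'.Nodup ∧ l.prod = l'.prod * c ^ 2
  | [], _ => ⟨[], 1, by simp, List.nodup_nil, by simp⟩
  | g :: t, h => by
    obtain ⟨t', c, ht'G, hnd, hprod⟩ := list_prod_eq_nodup_mul_sq G t fun x hx => h x (by simp [hx])
    have hg : g ∈ G := h g (by simp)
    by_cases hgt : g ∈ t'
    · refine ⟨t'.erase g, g * c, fun x hx => ht'G x (List.mem_of_mem_erase hx), hnd.erase g, ?_⟩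
      rw [List.prod_cons, hprod, ← List.prod_erase hgt]
      ring
    · refine ⟨g :: t', c, fun x hx => ?_, List.nodup_cons.mpr ⟨hgt, hnd⟩, ?_⟩
      · rcases List.mem_cons.mp hx with rfl | hx
        · exact hg
        · exact ht'G x hx
      · rw [List.prod_cons, List.prod_cons, hprod]; ring

/-- **All prime factors above `S`** (`3`-torsion version): if every prime containing `a ≠ 0`
contains `D`, then `a · u · ∏ l` is a square for a unit `u` and a duplicate-free sublist `l` of `G`
(`(a)³ = (∏ L)`, `a ≡ a³` modulo squares, repeated factors removed). [folklore] -/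
theorem exists_isSquare_mul_of_support_of_cube (D : 𝓞 K) (G : List (𝓞 K))
    (hD : ∀ v : HeightOneSpectrum (𝓞 K), D ∈ v.asIdeal → ∃ g ∈ G, v.asIdeal ^ 3 = span {g})
    (a : 𝓞 K) (ha : a ≠ 0)
    (hsupp : ∀ v : HeightOneSpectrum (𝓞 K), a ∈ v.asIdeal → D ∈ v.asIdeal) :
    ∃ (u : (𝓞 K)ˣ) (l : List (𝓞 K)), (∀ g ∈ l, g ∈ G) ∧ l.Nodup ∧
      IsSquare ((a : K) * (u : 𝓞 K) * (l.prod : 𝓞 K)) := by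
  classical
  obtain ⟨L, hLG, hL⟩ := ideal_cube_eq_span_prod D G hD (span {a})
    (by rwa [Ne, span_singleton_eq_bot]) fun v hv => hsupp v ((span_singleton_le_iff_mem _).mp hv)
  rw [span_singleton_pow, span_singleton_eq_span_singleton] at hL
  obtain ⟨ε, hε⟩ := hL
  -- `a³ ε = ∏ L`
  obtain ⟨l, c, hlG, hnd, hprod⟩ := list_prod_eq_nodup_mul_sq G L hLG
  refine ⟨ε, l, hlG, hnd, (l.prod : K) * c / a, ?_⟩
  have ha0 : (a : K) ≠ 0 := by exact_mod_cast ha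
  have key : ((a ^ 3 * (ε : 𝓞 K) : 𝓞 K) : K) = ((l.prod * c ^ 2 : 𝓞 K) : K) := by
    rw [← hprod]; exact_mod_cast hε
  push_cast at key
  field_simp
  linear_combination (l.prod : K) * key

/-! ### The integral case for `3`-torsion class groups -/

/-- **The integral case.** Every ideal class of `𝓞 K` has order dividing `3`, and every prime
`v ∋ D` has `v³ = (g)` for some `g ∈ G`: every non-zero `a ∈ 𝓞 K` with `ord_v(a)` even for all
`v ∌ D` is a unit times a duplicate-free product of members of `G` times a square (induction on the
number of primes `∌ D` dividing `(a)`, through `P³ = (π)`).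
[cite: SilvermanAEC2009, Prop. VIII.1.6 (proof)] -/
theorem exists_isSquare_mul_of_two_dvd_log_valuation_int_of_cube
    (h3 : ∀ I : (Ideal (𝓞 K))⁰, ClassGroup.mk0 I ^ 3 = 1) (D : 𝓞 K) (G : List (𝓞 K))
    (hD : ∀ v : HeightOneSpectrum (𝓞 K), D ∈ v.asIdeal → ∃ g ∈ G, v.asIdeal ^ 3 = span {g}) :
    ∀ (a : 𝓞 K), a ≠ 0 →
      (∀ v : HeightOneSpectrum (𝓞 K), D ∉ v.asIdeal →
        (2 : ℤ) ∣ WithZero.log (v.valuation K (a : K))) →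
      ∃ (u : (𝓞 K)ˣ) (l : List (𝓞 K)), (∀ g ∈ l, g ∈ G) ∧ l.Nodup ∧
        IsSquare ((a : K) * (u : 𝓞 K) * (l.prod : 𝓞 K)) := by
  suffices key : ∀ (s : ℕ) (a : 𝓞 K) (ha : a ≠ 0), (badSupport D a ha).card = s →
      (∀ v : HeightOneSpectrum (𝓞 K), D ∉ v.asIdeal →
        (2 : ℤ) ∣ WithZero.log (v.valuation K (a : K))) →
      ∃ (u : (𝓞 K)ˣ) (l : List (𝓞 K)), (∀ g ∈ l, g ∈ G) ∧ l.Nodup ∧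
        IsSquare ((a : K) * (u : 𝓞 K) * (l.prod : 𝓞 K)) from
    fun a ha hval => key _ a ha rfl hval
  intro s
  induction s using Nat.strong_induction_on with
  | _ s ih =>
  intro a ha hs hval
  classical
  by_cases hempty : badSupport D a ha = ∅
  · -- every prime dividing `(a)` contains `D`
    refine exists_isSquare_mul_of_support_of_cube D G hD a ha fun v hv => ?_
    by_contra hDv
    have : v ∈ badSupport D a ha := mem_badSupport.mpr ⟨hv, hDv⟩
    rw [hempty] at this
    exact Finset.notMem_empty v this
  · obtain ⟨P, hP⟩ := Finset.nonempty_of_ne_empty hempty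
    obtain ⟨haP, hDP⟩ := mem_badSupport.mp hP
    -- `e = ord_P(a)`, even and positive
    obtain ⟨e', he'⟩ := hval P hDP
    have hneg : WithZero.log (P.valuation K (a : K)) < 0 := (log_valuation_neg_iff_mem P ha).mpr haP
    obtain ⟨e, he⟩ : ∃ e : ℕ, WithZero.log (P.valuation K (a : K)) = -(2 * (e : ℤ)) :=
      ⟨(-e').toNat, by rw [he']; omega⟩
    -- `P³ = (π)`
    have hPh : (P.asIdeal ^ 3).IsPrincipal := by
      have hP0 : P.asIdeal ∈ (Ideal (𝓞 K))⁰ := mem_nonZeroDivisors_of_ne_zero P.ne_bot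
      have := (ClassGroup.mk0_eq_one_iff (pow_mem hP0 3)).mp (by
        rw [show (⟨P.asIdeal ^ 3, pow_mem hP0 3⟩ : (Ideal (𝓞 K))⁰) =
          ⟨P.asIdeal, hP0⟩ ^ 3 from Subtype.ext (by rw [SubmonoidClass.coe_pow]), map_pow]
        exact h3 _)
      exact this
    obtain ⟨π, hπ⟩ : ∃ π : 𝓞 K, span {π} = P.asIdeal ^ 3 :=
      ⟨hPh.generator, by rw [Ideal.span_singleton_generator]⟩
    have hπ0 : π ≠ 0 := by
      intro h0
      rw [h0, span_singleton_eq_bot.mpr rfl] at hπ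
      exact pow_ne_zero 3 P.ne_bot hπ.symm
    have hlogπ := log_valuation_of_span_eq_pow (K := K) hπ
    -- `π^(2e) ∣ a^3`
    have hdvd : π ^ (2 * e) ∣ a ^ 3 := by
      rw [← mem_span_singleton, ← span_singleton_pow, hπ, ← pow_mul,
        mem_pow_iff_log_valuation_le P (pow_ne_zero 3 ha)]
      push_cast
      rw [map_pow, WithZero.log_pow, he]
      simp only [nsmul_eq_mul]
      push_cast
      nlinarith
    obtain ⟨a₁, ha₁⟩ := hdvd
    have ha₁0 : a₁ ≠ 0 := by
      rintro rfl
      rw [mul_zero] at ha₁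
      exact pow_ne_zero 3 ha ha₁
    -- valuations of `a₁`
    have hloga₁ : ∀ v : HeightOneSpectrum (𝓞 K), WithZero.log (v.valuation K (a₁ : K)) =
        3 * WithZero.log (v.valuation K (a : K)) -
          2 * e * WithZero.log (v.valuation K (π : K)) := by
      intro v
      have hne : ∀ {r : 𝓞 K}, r ≠ 0 → v.valuation K (r : K) ≠ 0 := fun hr =>
        (v.valuation K).ne_zero_iff.mpr (by exact_mod_cast hr)
      have key := congrArg (fun r : 𝓞 K => WithZero.log (v.valuation K (r : K))) ha₁
      push_cast at key
      rw [map_pow, map_mul, map_pow, WithZero.log_pow, WithZero.log_mul (pow_ne_zero _ (hne hπ0))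
        (hne ha₁0), WithZero.log_pow] at key
      simp only [nsmul_eq_mul] at key
      push_cast at key
      linarith
    -- the bad support shrinks
    have hsub : badSupport D a₁ ha₁0 ⊆ (badSupport D a ha).erase P := by
      intro v hv
      obtain ⟨hav, hDv⟩ := mem_badSupport.mp hv
      have hlt := (log_valuation_neg_iff_mem v ha₁0).mpr hav
      rw [hloga₁ v, hlogπ v] at hlt
      rw [Finset.mem_erase, mem_badSupport]
      refine ⟨fun hvP => ?_, ?_, hDv⟩
      · rw [if_pos hvP, hvP, he] at hlt
        push_cast at hlt
        nlinarith
      · split_ifs at hlt with hvP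
        · rw [hvP, he] at hlt; push_cast at hlt; nlinarith
        · rw [mul_zero, sub_zero] at hlt
          exact (log_valuation_neg_iff_mem v ha).mp (by nlinarith)
    have hcard : (badSupport D a₁ ha₁0).card < s := by
      calc (badSupport D a₁ ha₁0).card ≤ ((badSupport D a ha).erase P).card :=
            Finset.card_le_card hsub
        _ < (badSupport D a ha).card := Finset.card_erase_lt_of_mem hP
        _ = s := hs
    -- parity for `a₁`
    have hval₁ : ∀ v : HeightOneSpectrum (𝓞 K), D ∉ v.asIdeal →
        (2 : ℤ) ∣ WithZero.log (v.valuation K (a₁ : K)) := by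
      intro v hDv
      rw [hloga₁ v]
      obtain ⟨c, hc⟩ := hval v hDv
      rw [hc]
      exact Dvd.dvd.sub ⟨3 * c, by ring⟩ ⟨e * WithZero.log (v.valuation K (π : K)), by ring⟩
    obtain ⟨u, l, hlG, hnd, w, hw⟩ := ih _ hcard a₁ ha₁0 rfl hval₁
    refine ⟨u, l, hlG, hnd, (π : K) ^ e * w / (a : K), ?_⟩
    have ha0 : (a : K) ≠ 0 := by exact_mod_cast ha
    have key : ((a : K)) ^ 3 = (π : K) ^ (2 * e) * a₁ := by exact_mod_cast ha₁
    rw [div_mul_div_comm, eq_div_iff (mul_ne_zero ha0 ha0)]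
    linear_combination ((u : 𝓞 K) * (l.prod : 𝓞 K) : K) * key + (π : K) ^ (2 * e) * hw

/-- **`K(S, 2)` is spanned by units and generators of the cubes of the primes above `S` when the
class group is `3`-torsion.** Let every ideal class of `𝓞 K` have order dividing `3`, `D ∈ 𝓞 K`,
and `G` a list such that every prime ideal `v ∋ D` has `v³ = (g)` for some `g ∈ G`. If `b ∈ Kˣ` has
`ord_v(b) ≡ 0 (mod 2)` for every finite place `v` with `D ∉ v`, then `b · u · ∏ l` is a square in
`K` for some unit `u` and some duplicate-free sublist `l` of `G`.
[cite: SilvermanAEC2009, Prop. VIII.1.6 (proof)] -/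
theorem exists_isSquare_mul_of_two_dvd_log_valuation_of_cube
    (h3 : ∀ I : (Ideal (𝓞 K))⁰, ClassGroup.mk0 I ^ 3 = 1) (D : 𝓞 K) (G : List (𝓞 K))
    (hD : ∀ v : HeightOneSpectrum (𝓞 K), D ∈ v.asIdeal → ∃ g ∈ G, v.asIdeal ^ 3 = span {g})
    {b : K} (hb : b ≠ 0)
    (hval : ∀ v : HeightOneSpectrum (𝓞 K), D ∉ v.asIdeal →
      (2 : ℤ) ∣ WithZero.log (v.valuation K b)) :
    ∃ (u : (𝓞 K)ˣ) (l : List (𝓞 K)), (∀ g ∈ l, g ∈ G) ∧ l.Nodup ∧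
      IsSquare (b * (u : 𝓞 K) * (l.prod : 𝓞 K)) := by
  obtain ⟨x, y, hy, hxy⟩ := IsFractionRing.div_surjective (A := 𝓞 K) b
  have hy0 : y ≠ 0 := nonZeroDivisors.ne_zero hy
  have hy0' : (y : K) ≠ 0 := by exact_mod_cast hy0
  have hx0 : x ≠ 0 := by
    rintro rfl
    rw [map_zero, zero_div] at hxy
    exact hb hxy.symm
  have ha : ((x * y : 𝓞 K) : K) = b * (y : K) ^ 2 := by
    rw [← hxy]; push_cast; field_simp
  have hval' : ∀ v : HeightOneSpectrum (𝓞 K), D ∉ v.asIdeal →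
      (2 : ℤ) ∣ WithZero.log (v.valuation K ((x * y : 𝓞 K) : K)) := by
    intro v hv
    rw [ha]
    refine (two_dvd_log_valuation_mul_iff v hb (pow_ne_zero 2 hy0') ?_).mpr (hval v hv)
    rw [map_pow, WithZero.log_pow]
    exact ⟨_, by rw [two_nsmul, two_mul]⟩
  obtain ⟨u, l, hlG, hnd, w, hw⟩ := exists_isSquare_mul_of_two_dvd_log_valuation_int_of_cube
    h3 D G hD (x * y) (mul_ne_zero hx0 hy0) hval'
  refine ⟨u, l, hlG, hnd, w / y, ?_⟩
  rw [ha] at hw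
  field_simp
  linear_combination hw

/-- The `3`-torsion hypothesis from `ker3 K = ⊤`. [folklore] -/
theorem pow_three_eq_one_of_ker3_eq_top (h : MonicCubic.ker3 K = ⊤) (I : (Ideal (𝓞 K))⁰) :
    ClassGroup.mk0 I ^ 3 = 1 := by
  have hs : ClassGroup.mk0 I ∈ MonicCubic.ker3 K := h ▸ Subgroup.mem_top _
  simpa [MonicCubic.ker3, MonoidHom.mem_ker, powMonoidHom_apply] using hs

end Literature.NumberTheory.NumberFields

end
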